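import Literature.Geometry.Kaehler.AnalyticSetDeformation

/-!
# The limit cone of the support of a holomorphic chain; blow-ups concentrate near it

Two facts feeding the proof of King's tangent cone theorem
(`Literature.Geometry.Kaehler.King1971_tangentCone`) at an arbitrary (singular) point `b` of
the support of a holomorphic `p`-chain `T` on `Ω ⊆ V`:

* `HolomorphicChain.hasPureDim_support` — the support `|T| = ⋃ Aⱼ` of a chain with nonempty
  support has pure dimension `p` (regular points of a locally finite union are regular points of
  one of the pieces, `IsRegularPointOfCodim.of_union`, [Chirka1989, §11.5]);
* `HolomorphicChain.eventually_forall_mem_of_blowUp` — **the blown-up supports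
  `(|T| − b)/r ∩ 𝐁(0,1)` converge to the limit cone**: for every open `U ⊇ F ∩ 𝐁(0,1)`,
  `F = limitCone |T| hb` (the central fibre of the deformation space,
  `AnalyticSetDeformation.lean`, which contains every limit of directions `yₖ → y` with
  `b + rₖ yₖ ∈ |T|`, `rₖ → 0⁺`), all points `y ∈ 𝐁(0,1)` with `b + r y ∈ |T|` lie in `U` once
  `r > 0` is small (compactness of `𝐁(0,1) ∖ U`).

Theorems only; no named facts.

## References

* E. M. Chirka, *Complex Analytic Sets*, Kluwer 1989, §8.1 (tangent cones), §11.5 (chains)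
  [Chirka1989].
* R. Harvey, *Holomorphic chains and their boundaries*, PSPUM XXX.1 (1977), §1.10 [Harvey1977].
-/

open scoped Manifold Topology
open Set Filter Function TopologicalSpace Metric

namespace Literature.Geometry.Kaehler

variable {V : Type*} [NormedAddCommGroup V] [NormedSpace ℂ V] [FiniteDimensional ℂ V]

/-! ### Regular points of finite unions of sets of pure codimension -/

section PureUnion

variable {E : Type*} [NormedAddCommGroup E] [NormedSpace ℂ E]
  {H : Type*} [TopologicalSpace H] {I : ModelWithCorners ℂ E H}
  {M : Type*} [TopologicalSpace M] [ChartedSpace H M]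
  [FiniteDimensional ℂ E] [IsManifold I 1 M] [I.Boundaryless]

/-- **Regular points of a finite union of analytic sets of pure codimension `c` have codimension
`c`** (they are regular points, of the same codimension, of one of the pieces).
[cite: Chirka1989, §5.3 Cor. 2 with §2.3] -/
theorem codim_eq_of_biUnion_finset_hasPureCodim {ι : Type*} (s : Finset ι) {S : ι → Set M} {c : ℕ}
    (hS : ∀ i ∈ s, HasPureCodim I (S i) c) :
    ∀ x ∈ regularLocus I (⋃ i ∈ s, S i), ∀ q : ℕ,
      IsRegularPointOfCodim I (⋃ i ∈ s, S i) q x → q = c := by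
  classical
  induction s using Finset.induction_on with
  | empty =>
    intro x hx
    simp only [Finset.notMem_empty, iUnion_of_empty, iUnion_empty] at hx
    exact absurd hx.1 (notMem_empty x)
  | insert a s ha ih =>
    have hu : (⋃ i ∈ insert a s, S i) = S a ∪ ⋃ i ∈ s, S i := Finset.set_biUnion_insert a s S
    rw [hu]
    intro x hx q hq
    have hSa : HasPureCodim I (S a) c := hS a (Finset.mem_insert_self a s)
    have hrest : IsAnalyticSet I (⋃ i ∈ s, S i) :=
      isAnalyticSet_biUnion_finset s fun i hi => (hS i (Finset.mem_insert_of_mem hi)).1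
    rcases hq.of_union (hSa.1 x) hrest.isClosed hx with ⟨hxS, h⟩ | ⟨hxS', h⟩
    · exact h.codim_unique hxS (hSa.2.2 x ⟨hxS, q, h⟩)
    · exact ih (fun i hi => hS i (Finset.mem_insert_of_mem hi)) x ⟨hxS', q, h⟩ q h

end PureUnion

/-! ### The support of a chain has pure dimension `p` -/

section Support

variable {Ω : Opens V} {p : ℕ}

/-- **The support of a holomorphic `p`-chain with nonempty support has pure dimension `p`**: near
each point it is a finite union of components (`HolomorphicChain.exists_nhds_finite`), each of
pure codimension `dim V − p`. [cite: Chirka1989, §11.5, p. 130] -/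
theorem HolomorphicChain.hasPureDim_support (T : HolomorphicChain 𝓘(ℂ, V) Ω p)
    (hne : T.support.Nonempty) : HasPureDim 𝓘(ℂ, V) T.support p := by
  classical
  haveI : LocallyCompactSpace Ω := Ω.isOpen.locallyCompactSpace
  -- some component, so `p ≤ dim V`
  obtain ⟨x₀, hx₀⟩ := hne
  obtain ⟨Z₀, hZ₀, -⟩ := HolomorphicChain.mem_support_iff.1 hx₀
  have hp : p ≤ Module.finrank ℂ V := (T.hasPureDim_of_mult_ne_zero hZ₀).le_finrank
  rw [hasPureDim_iff hp]
  refine ⟨T.isAnalyticSet_support, ⟨x₀, hx₀⟩, fun x hx => ?_⟩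
  obtain ⟨hxS, q, hq⟩ := hx
  suffices hqc : q = Module.finrank ℂ V - p by rwa [hqc] at hq
  -- localise to the finitely many components meeting a neighbourhood of `x`
  obtain ⟨U, hU, hfin⟩ := T.exists_nhds_finite x
  obtain ⟨W, hWU, hW, hxW⟩ := _root_.mem_nhds_iff.1 hU
  set F : Set Ω := ⋃ Z ∈ hfin.toFinset, Z with hF
  have hFS : T.support ∩ W = F ∩ W := by
    ext y
    simp only [mem_inter_iff, hF, mem_iUnion, Finite.mem_toFinset, mem_setOf_eq, exists_prop,
      HolomorphicChain.mem_support_iff]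
    constructor
    · rintro ⟨⟨Z, hZ, hyZ⟩, hyW⟩
      exact ⟨⟨Z, ⟨hZ, y, hWU hyW, hyZ⟩, hyZ⟩, hyW⟩
    · rintro ⟨⟨Z, ⟨hZ, -⟩, hyZ⟩, hyW⟩
      exact ⟨⟨Z, hZ, hyZ⟩, hyW⟩
  have hqF : IsRegularPointOfCodim 𝓘(ℂ, V) F q x := hq.congr_set hW hxW hFS
  have hxF : x ∈ F := by
    have : x ∈ F ∩ W := hFS ▸ ⟨hxS, hxW⟩
    exact this.1
  refine codim_eq_of_biUnion_finset_hasPureCodim hfin.toFinset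
    (S := fun Z : Set Ω => Z) (fun Z hZ => ?_) x ⟨hxF, q, hqF⟩ q hqF
  exact (T.hasPureDim_of_mult_ne_zero ((hfin.mem_toFinset).1 hZ).1).hasPureCodim

end Support

/-! ### Blown-up supports concentrate near the limit cone -/

section BlowUp

variable {Ω : Opens V} {p : ℕ}

/-- **The blown-up supports converge to the limit cone.** Let `F = limitCone |T| hb` and let `U`
be an open set containing `F ∩ 𝐁(0, 1)`. Then for all sufficiently small `r > 0`, every
`y ∈ 𝐁(0,1)` with `b + r y ∈ |T|` lies in `U`: otherwise a sequence `rₖ → 0⁺`, `yₖ ∈ 𝐁(0,1) ∖ U`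
with `b + rₖ yₖ ∈ |T|` has a convergent subsequence, whose limit lies in `F ∩ 𝐁(0,1) ∖ U`
(`mem_limitCone_of_tendsto`) — absurd. [cite: Chirka1989, §8.1 Prop. 1] -/
theorem HolomorphicChain.eventually_forall_mem_of_blowUp (T : HolomorphicChain 𝓘(ℂ, V) Ω p)
    {b : V} (hb : b ∈ (Ω : Set V)) {U : Set V} (hU : IsOpen U)
    (hFU : limitCone T.support hb ∩ closedBall (0 : V) 1 ⊆ U) :
    ∀ᶠ r in 𝓝[>] (0 : ℝ), ∀ y ∈ closedBall (0 : V) 1,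
      b + r • y ∈ ((↑) : Ω → V) '' T.support → y ∈ U := by
  letI : NormedSpace ℝ V := NormedSpace.complexToReal
  by_contra hcon
  -- a sequence of bad radii and directions
  have hbad : ∀ k : ℕ, ∃ r : ℝ, 0 < r ∧ r < 1 / (k + 1) ∧ ∃ y ∈ closedBall (0 : V) 1,
      b + r • y ∈ ((↑) : Ω → V) '' T.support ∧ y ∉ U := by
    intro k
    by_contra hk
    push Not at hk
    apply hcon
    have hmem : Ioo (0 : ℝ) (1 / (k + 1)) ∈ 𝓝[>] (0 : ℝ) := Ioo_mem_nhdsGT (by positivity)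
    filter_upwards [hmem] with r hr y hy hyA
    exact hk r hr.1 hr.2 y hy hyA
  choose r hr0 hrk ys hys hysA hysU using hbad
  -- compactness of `𝐁(0,1) ∖ U`
  have hK : IsCompact (closedBall (0 : V) 1 \ U) := (isCompact_closedBall 0 1).diff hU
  obtain ⟨y, hyK, φ, hφ, hlim⟩ := hK.tendsto_subseq (x := ys) fun k => ⟨hys k, hysU k⟩
  -- the limit lies in the limit cone
  have hr0' : Tendsto (r ∘ φ) atTop (𝓝 0) := by
    have h1 : Tendsto r atTop (𝓝 0) := by
      refine squeeze_zero (fun k => (hr0 k).le) (fun k => (hrk k).le) ?_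
      exact tendsto_one_div_add_atTop_nhds_zero_nat
    exact h1.comp hφ.tendsto_atTop
  have hyF : y ∈ limitCone T.support hb := by
    refine mem_limitCone_of_tendsto hb (r := r ∘ φ) (fun k => hr0 _) hr0' hlim fun k => ?_
    rw [Complex.coe_smul]
    exact hysA (φ k)
  exact hyK.2 (hFU ⟨hyF, hyK.1⟩)

/-- Thickened form: with `U = {y : infDist y (F ∩ 𝐁(0,1)) < ε}` — for small `r > 0` every direction
`y ∈ 𝐁(0,1)` with `b + r y ∈ |T|` is within `ε` of `F ∩ 𝐁(0, 1)` (vacuous, `infDist = 0`, if the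
latter is empty). [cite: Chirka1989, §8.1 Prop. 1] -/
theorem HolomorphicChain.eventually_forall_infDist_lt_of_blowUp (T : HolomorphicChain 𝓘(ℂ, V) Ω p)
    {b : V} (hb : b ∈ (Ω : Set V)) {ε : ℝ} (hε : 0 < ε) :
    ∀ᶠ r in 𝓝[>] (0 : ℝ), ∀ y ∈ closedBall (0 : V) 1,
      b + r • y ∈ ((↑) : Ω → V) '' T.support →
        infDist y (limitCone T.support hb ∩ closedBall (0 : V) 1) < ε := by
  refine T.eventually_forall_mem_of_blowUp hb (U := {y | infDist y
    (limitCone T.support hb ∩ closedBall (0 : V) 1) < ε}) ?_ fun y hy => ?_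
  · exact isOpen_lt (continuous_infDist_pt _) continuous_const
  · rw [mem_setOf_eq, infDist_zero_of_mem hy]
    exact hε

end BlowUp

end Literature.Geometry.Kaehler
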